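import Summits.QuantumAdvantage.QuantumAdvantage.Theorems.ArithStatLadderIqThreeMemBQPOrderBitValid
import Summits.QuantumAdvantage.QuantumAdvantage.Theorems.ArithStatLadderIqThreeMemBQPSelectorWrap
import Literature.Computability.QuantumComplexity.PolyMajority
import Literature.Computability.QuantumComplexity.CWrapAssembly
import Literature.Computability.QuantumComplexity.BPPRelSubsetBQPRel
import Literature.Computability.QuantumComplexity.PromiseWrap
import Literature.Computability.Cryptography.ClassBQPComplementProofs
import Literature.Computability.Cryptography.ShorProofs
import HarnessLib

/-!
# Crux `ArithStatLadder.IqThreeMemBQP` (stmt-QuantumAdvantage-2424), line `scholz-mirror-siegel` — the guarded order-bit language, II (support of stub S6b)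

Second half of the support file `…IqThreeMemBQPOrderBitValid.lean` of the registered stub
`stub_realWitnessOfParts` (S6b): the order bit of the `(S5)` family read by classical post-processing
(`exists_orderBit_family`, `CWrap.kernelProb_family_ge`), its majority amplification
(`exists_orderBit_family_amplified`, `PolyMajority.exists_poly_amplified`), the slack form on ALL inputs
(`exists_orderBit_family_slack`), and the conclusion `L₅ = VALID ∩ YES ∈ BQP` (`orderBitLang_mem_BQP`) by oracle
pre-processing with the validity selector of part I (`selector_exists`, `SelectorWrap.selectorWrap_isQSolvable` (the oracle wrap, sister file `…SelectorWrap`):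
`BQP^BQP = BQP` for search problems) and `mem_BQP_of_isQSolvable_bit`.
-/

set_option linter.dupNamespace false -- D-0017: single-problem summit ⇒ QuantumAdvantage.QuantumAdvantage by design

noncomputable section

namespace Summit.QuantumAdvantage.QuantumAdvantage.Theorems.ArithStatLadder.IqThreeMemBQP

open scoped NumberField nonZeroDivisors
open _root_.Computability Polynomial
open Literature.Computability.Complexity Literature.Computability.Complexity.Brick
open Literature.Computability.Complexity.CodeFP Literature.Computability.Complexity.AdQuery
open Literature.Computability.Cryptography Literature.Computability.QuantumComplexity
open Literature.NumberTheory.QuadraticFields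
open Literature.Computability.Complexity.Knapsack (decNatList canonLFn canonLFn_eq canonLFn_mem_FP decNatList_encode)

/-! ### The order bit of the `(S5)` family -/

/-- **The order-bit reader** (`FP`): `⟨x, y⟩ ↦ [3 ∣ ⟦fst y⟧]`. [folklore] -/
theorem orderBitPost_exists : ∃ g : List Bool → List Bool, g ∈ FP ∧ ∀ x y : List Bool,
    g (boolPair x y) = [decide (bitsToNat (fstF y) % 3 = 0)] := by
  have c : CodeFP (pairE strE strE) bitE (fun t => decide (bitsToNat (fstF t.2) % 3 = 0)) :=
    (natEq.comp ((natMod.comp ((strVal.comp (CodeFP.comp (β := List Bool) (eβ := strE) ⟨fstF, fstF_mem_FP, fun _ => rfl⟩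
      (snd strE strE))).pair (const _ 3))).pair (const _ 0))).congr fun _ => rfl
  obtain ⟨g, hg, hgs⟩ := c
  refine ⟨g, hg, fun x y => ?_⟩
  have := hgs (x, y)
  simp only [pairE_apply, strE, id, bitE] at this
  exact this

/-- **The first-bit reader** (`FP`): `⟨x, y⟩ ↦ [y₀]` (`false` on the empty string). [folklore] -/
theorem headBitPost_exists : ∃ g : List Bool → List Bool, g ∈ FP ∧ ∀ x y : List Bool,
    g (boolPair x y) = [y.getD 0 false] := by
  obtain ⟨g, hg, hgs⟩ := strGetDNat.comp ((snd strE strE).pair (const _ 0))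
  refine ⟨g, hg, fun x y => ?_⟩
  have := hgs (x, y)
  simp only [pairE_apply, strE, id, bitE] at this
  exact this

/-- `[true]` is a prefix iff the first letter (default `false`) is `true`. [folklore] -/
theorem prefix_true_iff_getD (y : List Bool) : [true] <+: y ↔ y.getD 0 false = true := by
  cases y with
  | nil => simp
  | cons b t => simp

/-- **The order bit is correct with probability `≥ 2/3` on valid instances.** From the `(S5)` solver
(answers `⟨bin ord, ·⟩` on valid instances, every model) and the classical post-processing `[3 ∣ ord]`
(`CWrap.kernelProb_family_ge`): an oracle-free uniform family accepting valid yes-instances with probability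
`≥ 2/3` and valid no-instances with probability `≤ 1/3`. [cite: BernsteinVazirani1997, §8 Thm. 8.3; Aaronson2010, §1] -/
theorem exists_orderBit_family
    (hS5 : IsQSolvable fun x : List Bool =>
      {y | ∀ (F : Type) [Field F] [NumberField F] (m a r : ℕ) (α : 𝓞 F),
        x = boolPair (encodeNat m) (boolPair (encodeNat a) (encodeNat r)) →
          Squarefree m → 2 ≤ m → Module.finrank ℚ F = 2 → (α : F) ^ 2 = (m : F) → 0 < a →
            (a : ℤ) ∣ (r : ℤ) ^ 2 - m →
              ∀ hI : Ideal.span {(a : 𝓞 F), (r : 𝓞 F) + α} ∈ (Ideal (𝓞 F))⁰,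
                ∃ t : List Bool, y = boolPair (encodeNat (orderOf (ClassGroup.mk0 ⟨_, hI⟩))) t}) :
    ∃ F : QCircuitFamily cliffordT, F.IsOracleFree ∧ F.IsUniform ∧ ∀ x ∈ ({x : List Bool | ∃ m a r : ℕ, x = boolPair (encodeNat m) (boolPair (encodeNat a) (encodeNat r)) ∧ Squarefree m ∧ 2 ≤ m ∧ 0 < a ∧ (a : ℤ) ∣ (r : ℤ) ^ 2 - m} : Set (List Bool)),
      (x ∈ ({x : List Bool | ∀ (F : Type) [Field F] [NumberField F] (m a r : ℕ) (α : 𝓞 F),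
      x = boolPair (encodeNat m) (boolPair (encodeNat a) (encodeNat r)) → Squarefree m → 2 ≤ m →
        Module.finrank ℚ F = 2 → (α : F) ^ 2 = (m : F) → 0 < a → (a : ℤ) ∣ (r : ℤ) ^ 2 - m →
          ∀ hI : Ideal.span {(a : 𝓞 F), (r : 𝓞 F) + α} ∈ (Ideal (𝓞 F))⁰, 3 ∣ orderOf (ClassGroup.mk0 ⟨_, hI⟩)} : Set (List Bool)) → 2 / 3 ≤ F.acceptProbOn 0 x) ∧
      (x ∉ ({x : List Bool | ∀ (F : Type) [Field F] [NumberField F] (m a r : ℕ) (α : 𝓞 F),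
      x = boolPair (encodeNat m) (boolPair (encodeNat a) (encodeNat r)) → Squarefree m → 2 ≤ m →
        Module.finrank ℚ F = 2 → (α : F) ^ 2 = (m : F) → 0 < a → (a : ℤ) ∣ (r : ℤ) ^ 2 - m →
          ∀ hI : Ideal.span {(a : 𝓞 F), (r : 𝓞 F) + α} ∈ (Ideal (𝓞 F))⁰, 3 ∣ orderOf (ClassGroup.mk0 ⟨_, hI⟩)} : Set (List Bool)) → F.acceptProbOn 0 x ≤ 1 / 3) := by
  obtain ⟨F₅, hfree, hU, hk⟩ := hS5
  obtain ⟨g, hg, hgs⟩ := orderBitPost_exists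
  obtain ⟨P, hPh, hPg, hPF⟩ := CWrap.exists_params (PolyTimeComputable.id _) hg hU
  refine ⟨CWrap.family P, CWrap.family_isOracleFree P (hPF ▸ hfree), CWrap.family_isUniform P (hPF ▸ hU), ?_⟩
  rintro x ⟨m, a, r, rfl, hsf, hm, ha, hdvd⟩
  obtain ⟨F, _, _, α, h2, hα, hI⟩ := exists_model hsf hm ha r
  set b : Bool := decide (3 ∣ orderOf (ClassGroup.mk0 ⟨_, hI⟩)) with hb
  -- the event of the wrapped family contains the pulled-back solver event
  have hker := CWrap.kernelProb_family_ge P (boolPair (encodeNat m) (boolPair (encodeNat a) (encodeNat r))) (fun x =>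
      {y | ∀ (F : Type) [Field F] [NumberField F] (m a r : ℕ) (α : 𝓞 F),
        x = boolPair (encodeNat m) (boolPair (encodeNat a) (encodeNat r)) →
          Squarefree m → 2 ≤ m → Module.finrank ℚ F = 2 → (α : F) ^ 2 = (m : F) → 0 < a →
            (a : ℤ) ∣ (r : ℤ) ^ 2 - m →
              ∀ hI : Ideal.span {(a : 𝓞 F), (r : 𝓞 F) + α} ∈ (Ideal (𝓞 F))⁰,
                ∃ t : List Bool, y = boolPair (encodeNat (orderOf (ClassGroup.mk0 ⟨_, hI⟩))) t})
  rw [hPh, hPg, hPF] at hker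
  have hsub : {z : List Bool | ∃ y ∈ ({y | ∀ (F : Type) [Field F] [NumberField F] (m' a' r' : ℕ) (α : 𝓞 F),
        boolPair (encodeNat m) (boolPair (encodeNat a) (encodeNat r)) = boolPair (encodeNat m') (boolPair (encodeNat a') (encodeNat r')) →
          Squarefree m' → 2 ≤ m' → Module.finrank ℚ F = 2 → (α : F) ^ 2 = (m' : F) → 0 < a' →
            (a' : ℤ) ∣ (r' : ℤ) ^ 2 - m' →
              ∀ hI : Ideal.span {(a' : 𝓞 F), (r' : 𝓞 F) + α} ∈ (Ideal (𝓞 F))⁰,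
                ∃ t : List Bool, y = boolPair (encodeNat (orderOf (ClassGroup.mk0 ⟨_, hI⟩))) t} : Set (List Bool)),
        g (boolPair (boolPair (encodeNat m) (boolPair (encodeNat a) (encodeNat r))) y) <+: z} ⊆ {z | [b] <+: z} := by
      rintro z ⟨y, hy, hz⟩
      obtain ⟨t, rfl⟩ := hy F m a r α rfl hsf hm h2 hα ha hdvd hI
      rw [hgs, fstF_boolPair, bitsToNat_encodeNat] at hz
      have hbb : decide (orderOf (ClassGroup.mk0 ⟨_, hI⟩) % 3 = 0) = b := by
        rw [hb]; exact decide_eq_decide.2 Nat.dvd_iff_mod_eq_zero.symm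
      rw [hbb] at hz
      exact hz
  have h23 : 2 / 3 ≤ (CWrap.family P).kernelProb 0 (boolPair (encodeNat m) (boolPair (encodeNat a) (encodeNat r))) {z | [b] <+: z} :=
    ((hk _).trans hker).trans (kernelProb_mono _ _ _ hsub)
  have hyes := mem_yes_iff hsf hm h2 hα ha hdvd hI
  constructor
  · intro hY
    rw [hb, decide_eq_true (hyes.1 hY)] at h23
    rwa [← kernelProb_prefix_true_eq_acceptProbOn]
  · intro hN
    rw [hb, decide_eq_false (fun h => hN (hyes.2 h))] at h23
    have h1 := kernelProb_add_kernelProb_le_one (CWrap.family P) 0 (boolPair (encodeNat m) (boolPair (encodeNat a) (encodeNat r))) disjoint_prefix_true_false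
    rw [kernelProb_prefix_true_eq_acceptProbOn] at h1
    linarith

/-- **Amplified**: valid yes-instances accepted with probability `≥ 9/10`, valid no-instances with probability
`≤ 1/10` (majority over `90` parallel copies, `PolyMajority.exists_poly_amplified` with `η = 1/6`).
[cite: BennettBernsteinBrassardVazirani1997, Thm. 4.13] -/
theorem exists_orderBit_family_amplified
    (hS5 : IsQSolvable fun x : List Bool =>
      {y | ∀ (F : Type) [Field F] [NumberField F] (m a r : ℕ) (α : 𝓞 F),
        x = boolPair (encodeNat m) (boolPair (encodeNat a) (encodeNat r)) →
          Squarefree m → 2 ≤ m → Module.finrank ℚ F = 2 → (α : F) ^ 2 = (m : F) → 0 < a →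
            (a : ℤ) ∣ (r : ℤ) ^ 2 - m →
              ∀ hI : Ideal.span {(a : 𝓞 F), (r : 𝓞 F) + α} ∈ (Ideal (𝓞 F))⁰,
                ∃ t : List Bool, y = boolPair (encodeNat (orderOf (ClassGroup.mk0 ⟨_, hI⟩))) t}) :
    ∃ F : QCircuitFamily cliffordT, F.IsOracleFree ∧ F.IsUniform ∧ ∀ x ∈ ({x : List Bool | ∃ m a r : ℕ, x = boolPair (encodeNat m) (boolPair (encodeNat a) (encodeNat r)) ∧ Squarefree m ∧ 2 ≤ m ∧ 0 < a ∧ (a : ℤ) ∣ (r : ℤ) ^ 2 - m} : Set (List Bool)),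
      (x ∈ ({x : List Bool | ∀ (F : Type) [Field F] [NumberField F] (m a r : ℕ) (α : 𝓞 F),
      x = boolPair (encodeNat m) (boolPair (encodeNat a) (encodeNat r)) → Squarefree m → 2 ≤ m →
        Module.finrank ℚ F = 2 → (α : F) ^ 2 = (m : F) → 0 < a → (a : ℤ) ∣ (r : ℤ) ^ 2 - m →
          ∀ hI : Ideal.span {(a : 𝓞 F), (r : 𝓞 F) + α} ∈ (Ideal (𝓞 F))⁰, 3 ∣ orderOf (ClassGroup.mk0 ⟨_, hI⟩)} : Set (List Bool)) → 9 / 10 ≤ F.acceptProbOn 0 x) ∧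
      (x ∉ ({x : List Bool | ∀ (F : Type) [Field F] [NumberField F] (m a r : ℕ) (α : 𝓞 F),
      x = boolPair (encodeNat m) (boolPair (encodeNat a) (encodeNat r)) → Squarefree m → 2 ≤ m →
        Module.finrank ℚ F = 2 → (α : F) ^ 2 = (m : F) → 0 < a → (a : ℤ) ∣ (r : ℤ) ^ 2 - m →
          ∀ hI : Ideal.span {(a : 𝓞 F), (r : 𝓞 F) + α} ∈ (Ideal (𝓞 F))⁰, 3 ∣ orderOf (ClassGroup.mk0 ⟨_, hI⟩)} : Set (List Bool)) → F.acceptProbOn 0 x ≤ 1 / 10) := by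
  obtain ⟨F, hfree, hU, hF⟩ := exists_orderBit_family hS5
  obtain ⟨F', hfree', hU', hF'⟩ := exists_poly_amplified hfree hU (Polynomial.C 89) (η := 1 / 6) (by norm_num)
  refine ⟨F', hfree', hU', fun x hx => ?_⟩
  have hK : (1 : ℝ) / (4 * (((Polynomial.C 89 : Polynomial ℕ).eval x.length + 1 : ℕ) : ℝ) * (1 / 6 : ℝ) ^ 2) = 1 / 10 := by
    rw [Polynomial.eval_C]; norm_num
  obtain ⟨hy, hn⟩ := hF' x
  rw [hK] at hy hn
  obtain ⟨h1, h2⟩ := hF x hx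
  exact ⟨fun hY => by linarith [hy (by linarith [h1 hY])], fun hN => hn (by linarith [h2 hN])⟩

/-- **The order-bit relation is solved with slack on ALL inputs**: for the amplified family, the event "if the
input is valid then (first output bit `= 1` iff yes-instance)" has probability `≥ 2/3 + 1/5` on every input
(trivially `1` on invalid inputs). [cite: BennettBernsteinBrassardVazirani1997, Thm. 4.13 and Cor. 4.15] -/
theorem exists_orderBit_family_slack
    (hS5 : IsQSolvable fun x : List Bool =>
      {y | ∀ (F : Type) [Field F] [NumberField F] (m a r : ℕ) (α : 𝓞 F),
        x = boolPair (encodeNat m) (boolPair (encodeNat a) (encodeNat r)) →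
          Squarefree m → 2 ≤ m → Module.finrank ℚ F = 2 → (α : F) ^ 2 = (m : F) → 0 < a →
            (a : ℤ) ∣ (r : ℤ) ^ 2 - m →
              ∀ hI : Ideal.span {(a : 𝓞 F), (r : 𝓞 F) + α} ∈ (Ideal (𝓞 F))⁰,
                ∃ t : List Bool, y = boolPair (encodeNat (orderOf (ClassGroup.mk0 ⟨_, hI⟩))) t}) :
    ∃ F : QCircuitFamily cliffordT, F.IsOracleFree ∧ F.IsUniform ∧ ∃ δ : ℝ, 0 < δ ∧ ∀ u : List Bool,
      2 / 3 + δ ≤ F.kernelProb 0 u {y | u ∈ ({x : List Bool | ∃ m a r : ℕ, x = boolPair (encodeNat m) (boolPair (encodeNat a) (encodeNat r)) ∧ Squarefree m ∧ 2 ≤ m ∧ 0 < a ∧ (a : ℤ) ∣ (r : ℤ) ^ 2 - m} : Set (List Bool)) →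
        ([true] <+: y ↔ u ∈ ({x : List Bool | ∀ (F : Type) [Field F] [NumberField F] (m a r : ℕ) (α : 𝓞 F),
      x = boolPair (encodeNat m) (boolPair (encodeNat a) (encodeNat r)) → Squarefree m → 2 ≤ m →
        Module.finrank ℚ F = 2 → (α : F) ^ 2 = (m : F) → 0 < a → (a : ℤ) ∣ (r : ℤ) ^ 2 - m →
          ∀ hI : Ideal.span {(a : 𝓞 F), (r : 𝓞 F) + α} ∈ (Ideal (𝓞 F))⁰, 3 ∣ orderOf (ClassGroup.mk0 ⟨_, hI⟩)} : Set (List Bool)))} := by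
  classical
  obtain ⟨F, hfree, hU, hF⟩ := exists_orderBit_family_amplified hS5
  refine ⟨F, hfree, hU, 1 / 5, by norm_num, fun u => ?_⟩
  by_cases hu : u ∈ ({x : List Bool | ∃ m a r : ℕ, x = boolPair (encodeNat m) (boolPair (encodeNat a) (encodeNat r)) ∧ Squarefree m ∧ 2 ≤ m ∧ 0 < a ∧ (a : ℤ) ∣ (r : ℤ) ^ 2 - m} : Set (List Bool))
  · obtain ⟨hy, hn⟩ := hF u hu
    by_cases hY : u ∈ ({x : List Bool | ∀ (F : Type) [Field F] [NumberField F] (m a r : ℕ) (α : 𝓞 F),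
      x = boolPair (encodeNat m) (boolPair (encodeNat a) (encodeNat r)) → Squarefree m → 2 ≤ m →
        Module.finrank ℚ F = 2 → (α : F) ^ 2 = (m : F) → 0 < a → (a : ℤ) ∣ (r : ℤ) ^ 2 - m →
          ∀ hI : Ideal.span {(a : 𝓞 F), (r : 𝓞 F) + α} ∈ (Ideal (𝓞 F))⁰, 3 ∣ orderOf (ClassGroup.mk0 ⟨_, hI⟩)} : Set (List Bool))
    · have hsub : {y : List Bool | [true] <+: y} ⊆ {y | u ∈ ({x : List Bool | ∃ m a r : ℕ, x = boolPair (encodeNat m) (boolPair (encodeNat a) (encodeNat r)) ∧ Squarefree m ∧ 2 ≤ m ∧ 0 < a ∧ (a : ℤ) ∣ (r : ℤ) ^ 2 - m} : Set (List Bool)) →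
          ([true] <+: y ↔ u ∈ ({x : List Bool | ∀ (F : Type) [Field F] [NumberField F] (m a r : ℕ) (α : 𝓞 F),
      x = boolPair (encodeNat m) (boolPair (encodeNat a) (encodeNat r)) → Squarefree m → 2 ≤ m →
        Module.finrank ℚ F = 2 → (α : F) ^ 2 = (m : F) → 0 < a → (a : ℤ) ∣ (r : ℤ) ^ 2 - m →
          ∀ hI : Ideal.span {(a : 𝓞 F), (r : 𝓞 F) + α} ∈ (Ideal (𝓞 F))⁰, 3 ∣ orderOf (ClassGroup.mk0 ⟨_, hI⟩)} : Set (List Bool)))} := fun y hy' _ => ⟨fun _ => hY, fun _ => hy'⟩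
      refine le_trans ?_ (kernelProb_mono _ _ _ hsub)
      rw [kernelProb_prefix_true_eq_acceptProbOn]
      linarith [hy hY]
    · have hsub : {y : List Bool | [true] <+: y}ᶜ ⊆ {y | u ∈ ({x : List Bool | ∃ m a r : ℕ, x = boolPair (encodeNat m) (boolPair (encodeNat a) (encodeNat r)) ∧ Squarefree m ∧ 2 ≤ m ∧ 0 < a ∧ (a : ℤ) ∣ (r : ℤ) ^ 2 - m} : Set (List Bool)) →
          ([true] <+: y ↔ u ∈ ({x : List Bool | ∀ (F : Type) [Field F] [NumberField F] (m a r : ℕ) (α : 𝓞 F),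
      x = boolPair (encodeNat m) (boolPair (encodeNat a) (encodeNat r)) → Squarefree m → 2 ≤ m →
        Module.finrank ℚ F = 2 → (α : F) ^ 2 = (m : F) → 0 < a → (a : ℤ) ∣ (r : ℤ) ^ 2 - m →
          ∀ hI : Ideal.span {(a : 𝓞 F), (r : 𝓞 F) + α} ∈ (Ideal (𝓞 F))⁰, 3 ∣ orderOf (ClassGroup.mk0 ⟨_, hI⟩)} : Set (List Bool)))} := fun y hy' _ => ⟨fun h => absurd h hy', fun h => absurd h hY⟩
      refine le_trans ?_ (kernelProb_mono _ _ _ hsub)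
      have hc := QCircuitFamily.kernelProb_add_kernelProb_compl F 0 u {y : List Bool | [true] <+: y}
      rw [kernelProb_prefix_true_eq_acceptProbOn] at hc
      linarith [hn hY]
  · have huniv : {y : List Bool | u ∈ ({x : List Bool | ∃ m a r : ℕ, x = boolPair (encodeNat m) (boolPair (encodeNat a) (encodeNat r)) ∧ Squarefree m ∧ 2 ≤ m ∧ 0 < a ∧ (a : ℤ) ∣ (r : ℤ) ^ 2 - m} : Set (List Bool)) →
        ([true] <+: y ↔ u ∈ ({x : List Bool | ∀ (F : Type) [Field F] [NumberField F] (m a r : ℕ) (α : 𝓞 F),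
      x = boolPair (encodeNat m) (boolPair (encodeNat a) (encodeNat r)) → Squarefree m → 2 ≤ m →
        Module.finrank ℚ F = 2 → (α : F) ^ 2 = (m : F) → 0 < a → (a : ℤ) ∣ (r : ℤ) ^ 2 - m →
          ∀ hI : Ideal.span {(a : 𝓞 F), (r : 𝓞 F) + α} ∈ (Ideal (𝓞 F))⁰, 3 ∣ orderOf (ClassGroup.mk0 ⟨_, hI⟩)} : Set (List Bool)))} = Set.univ := Set.eq_univ_of_forall fun y h => absurd h hu
    rw [huniv, QCircuitFamily.kernelProb_univ_eq_one]
    norm_num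

/-! ### The guarded order-bit language is in `BQP` -/

/-- **`L₅ = VALID ∩ YES ∈ BQP`** from `(S5)`, without juxtaposition: oracle pre-processing by the validity
selector (`FP^FG`, `FG ∈ BQP` by Shor), the amplified order-bit family with slack `1/5` on all inputs, and
the first-bit reader (`SelectorWrap.selectorWrap_isQSolvable` (the oracle wrap, sister file `…SelectorWrap`), `BQP^BQP = BQP` for search problems); the resulting
solver writes the membership bit of `L₅` first on EVERY input (invalid inputs are sent to `x₀ ∉ YES`), so
`mem_BQP_of_isQSolvable_bit` applies. [cite: BennettBernsteinBrassardVazirani1997, Cor. 4.15; Aaronson2010, §1] -/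
theorem orderBitLang_mem_BQP :
    (IsQSolvable fun x : List Bool =>
      {y | ∀ (F : Type) [Field F] [NumberField F] (m a r : ℕ) (α : 𝓞 F),
        x = boolPair (encodeNat m) (boolPair (encodeNat a) (encodeNat r)) →
          Squarefree m → 2 ≤ m → Module.finrank ℚ F = 2 → (α : F) ^ 2 = (m : F) → 0 < a →
            (a : ℤ) ∣ (r : ℤ) ^ 2 - m →
              ∀ hI : Ideal.span {(a : 𝓞 F), (r : 𝓞 F) + α} ∈ (Ideal (𝓞 F))⁰,
                ∃ t : List Bool, y = boolPair (encodeNat (orderOf (ClassGroup.mk0 ⟨_, hI⟩))) t}) →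
    ({x : List Bool | x ∈ ({x : List Bool | ∃ m a r : ℕ, x = boolPair (encodeNat m) (boolPair (encodeNat a) (encodeNat r)) ∧ Squarefree m ∧ 2 ≤ m ∧ 0 < a ∧ (a : ℤ) ∣ (r : ℤ) ^ 2 - m} : Set (List Bool)) ∧
      x ∈ ({x : List Bool | ∀ (F : Type) [Field F] [NumberField F] (m a r : ℕ) (α : 𝓞 F),
      x = boolPair (encodeNat m) (boolPair (encodeNat a) (encodeNat r)) → Squarefree m → 2 ≤ m →
        Module.finrank ℚ F = 2 → (α : F) ^ 2 = (m : F) → 0 < a → (a : ℤ) ∣ (r : ℤ) ^ 2 - m →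
          ∀ hI : Ideal.span {(a : 𝓞 F), (r : 𝓞 F) + α} ∈ (Ideal (𝓞 F))⁰, 3 ∣ orderOf (ClassGroup.mk0 ⟨_, hI⟩)} : Set (List Bool))} : Language Bool) ∈ BQP := by
  intro hS5
  classical
  obtain ⟨hsel, hselFP, hval, hinv⟩ := selector_exists
  obtain ⟨g, hg, hgs⟩ := headBitPost_exists
  obtain ⟨F, hfree, hU, δ, hδ, hF⟩ := exists_orderBit_family_slack hS5
  have hq := SelectorWrap.selectorWrap_isQSolvable factorGraph_mem_BQP hselFP hg ⟨F, hfree, hU, δ, hδ, hF⟩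
  refine mem_BQP_of_isQSolvable_bit (fun _ _ => QCircuit.outputPMF_apply_holds) cliffordT_isUnitary_holds
    (L := {x : List Bool | x ∈ ({x : List Bool | ∃ m a r : ℕ, x = boolPair (encodeNat m) (boolPair (encodeNat a) (encodeNat r)) ∧ Squarefree m ∧ 2 ≤ m ∧ 0 < a ∧ (a : ℤ) ∣ (r : ℤ) ^ 2 - m} : Set (List Bool)) ∧ x ∈ ({x : List Bool | ∀ (F : Type) [Field F] [NumberField F] (m a r : ℕ) (α : 𝓞 F),
      x = boolPair (encodeNat m) (boolPair (encodeNat a) (encodeNat r)) → Squarefree m → 2 ≤ m →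
        Module.finrank ℚ F = 2 → (α : F) ^ 2 = (m : F) → 0 < a → (a : ℤ) ∣ (r : ℤ) ^ 2 - m →
          ∀ hI : Ideal.span {(a : 𝓞 F), (r : 𝓞 F) + α} ∈ (Ideal (𝓞 F))⁰, 3 ∣ orderOf (ClassGroup.mk0 ⟨_, hI⟩)} : Set (List Bool))})
    (bit := fun x => decide (x ∈ ({x : List Bool | ∃ m a r : ℕ, x = boolPair (encodeNat m) (boolPair (encodeNat a) (encodeNat r)) ∧ Squarefree m ∧ 2 ≤ m ∧ 0 < a ∧ (a : ℤ) ∣ (r : ℤ) ^ 2 - m} : Set (List Bool)) ∧ x ∈ ({x : List Bool | ∀ (F : Type) [Field F] [NumberField F] (m a r : ℕ) (α : 𝓞 F),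
      x = boolPair (encodeNat m) (boolPair (encodeNat a) (encodeNat r)) → Squarefree m → 2 ≤ m →
        Module.finrank ℚ F = 2 → (α : F) ^ 2 = (m : F) → 0 < a → (a : ℤ) ∣ (r : ℤ) ^ 2 - m →
          ∀ hI : Ideal.span {(a : 𝓞 F), (r : 𝓞 F) + α} ∈ (Ideal (𝓞 F))⁰, 3 ∣ orderOf (ClassGroup.mk0 ⟨_, hI⟩)} : Set (List Bool))))
    (fun x => decide_eq_true_iff) (hq.mono fun x z hz => ?_)
  obtain ⟨y, hy, hz⟩ := hz
  rw [hgs] at hz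
  simp only [Set.mem_setOf_eq] at hy
  by_cases hx : x ∈ ({x : List Bool | ∃ m a r : ℕ, x = boolPair (encodeNat m) (boolPair (encodeNat a) (encodeNat r)) ∧ Squarefree m ∧ 2 ≤ m ∧ 0 < a ∧ (a : ℤ) ∣ (r : ℤ) ^ 2 - m} : Set (List Bool))
  · rw [hval x hx] at hy
    have hiff := hy hx
    by_cases hY : x ∈ ({x : List Bool | ∀ (F : Type) [Field F] [NumberField F] (m a r : ℕ) (α : 𝓞 F),
      x = boolPair (encodeNat m) (boolPair (encodeNat a) (encodeNat r)) → Squarefree m → 2 ≤ m →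
        Module.finrank ℚ F = 2 → (α : F) ^ 2 = (m : F) → 0 < a → (a : ℤ) ∣ (r : ℤ) ^ 2 - m →
          ∀ hI : Ideal.span {(a : 𝓞 F), (r : 𝓞 F) + α} ∈ (Ideal (𝓞 F))⁰, 3 ∣ orderOf (ClassGroup.mk0 ⟨_, hI⟩)} : Set (List Bool))
    · rwa [decide_eq_true (show x ∈ ({x : List Bool | ∃ m a r : ℕ, x = boolPair (encodeNat m) (boolPair (encodeNat a) (encodeNat r)) ∧ Squarefree m ∧ 2 ≤ m ∧ 0 < a ∧ (a : ℤ) ∣ (r : ℤ) ^ 2 - m} : Set (List Bool)) ∧ x ∈ ({x : List Bool | ∀ (F : Type) [Field F] [NumberField F] (m a r : ℕ) (α : 𝓞 F),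
      x = boolPair (encodeNat m) (boolPair (encodeNat a) (encodeNat r)) → Squarefree m → 2 ≤ m →
        Module.finrank ℚ F = 2 → (α : F) ^ 2 = (m : F) → 0 < a → (a : ℤ) ∣ (r : ℤ) ^ 2 - m →
          ∀ hI : Ideal.span {(a : 𝓞 F), (r : 𝓞 F) + α} ∈ (Ideal (𝓞 F))⁰, 3 ∣ orderOf (ClassGroup.mk0 ⟨_, hI⟩)} : Set (List Bool)) from ⟨hx, hY⟩),
        ← (prefix_true_iff_getD y).1 (hiff.2 hY)]
    · rw [decide_eq_false (show ¬ (x ∈ ({x : List Bool | ∃ m a r : ℕ, x = boolPair (encodeNat m) (boolPair (encodeNat a) (encodeNat r)) ∧ Squarefree m ∧ 2 ≤ m ∧ 0 < a ∧ (a : ℤ) ∣ (r : ℤ) ^ 2 - m} : Set (List Bool)) ∧ x ∈ ({x : List Bool | ∀ (F : Type) [Field F] [NumberField F] (m a r : ℕ) (α : 𝓞 F),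
      x = boolPair (encodeNat m) (boolPair (encodeNat a) (encodeNat r)) → Squarefree m → 2 ≤ m →
        Module.finrank ℚ F = 2 → (α : F) ^ 2 = (m : F) → 0 < a → (a : ℤ) ∣ (r : ℤ) ^ 2 - m →
          ∀ hI : Ideal.span {(a : 𝓞 F), (r : 𝓞 F) + α} ∈ (Ideal (𝓞 F))⁰, 3 ∣ orderOf (ClassGroup.mk0 ⟨_, hI⟩)} : Set (List Bool))) from fun h => hY h.2)]
      have hf : y.getD 0 false = false := by
        rw [← Bool.not_eq_true, ← prefix_true_iff_getD]; exact fun h => hY (hiff.1 h)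
      rwa [hf] at hz
  · rw [hinv x hx] at hy
    have hiff := hy default_mem_valid
    rw [decide_eq_false (show ¬ (x ∈ ({x : List Bool | ∃ m a r : ℕ, x = boolPair (encodeNat m) (boolPair (encodeNat a) (encodeNat r)) ∧ Squarefree m ∧ 2 ≤ m ∧ 0 < a ∧ (a : ℤ) ∣ (r : ℤ) ^ 2 - m} : Set (List Bool)) ∧ x ∈ ({x : List Bool | ∀ (F : Type) [Field F] [NumberField F] (m a r : ℕ) (α : 𝓞 F),
      x = boolPair (encodeNat m) (boolPair (encodeNat a) (encodeNat r)) → Squarefree m → 2 ≤ m →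
        Module.finrank ℚ F = 2 → (α : F) ^ 2 = (m : F) → 0 < a → (a : ℤ) ∣ (r : ℤ) ^ 2 - m →
          ∀ hI : Ideal.span {(a : 𝓞 F), (r : 𝓞 F) + α} ∈ (Ideal (𝓞 F))⁰, 3 ∣ orderOf (ClassGroup.mk0 ⟨_, hI⟩)} : Set (List Bool))) from fun h => hx h.1)]
    have hf : y.getD 0 false = false := by
      rw [← Bool.not_eq_true, ← prefix_true_iff_getD]; exact fun h => default_not_mem_yes (hiff.1 h)
    rwa [hf] at hz

end Summit.QuantumAdvantage.QuantumAdvantage.Theorems.ArithStatLadder.IqThreeMemBQP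

end
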